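import Summits.ABC.StewartYu.PadicG3ParGA
import Summits.ABC.StewartYu.PadicG3ExitCPrep
import HarnessLib

/-!
# The `p`-adic Gen-3 parameter record v2 — part GB: floors of the gain-divided family, `yloadG ≤ 11 G`, `g^{n+1} ≤ 7^{n+1} K`

Support file (plain theorems; no named facts). Continues `PadicG3ParGA` (K-M3.2). Twins of `PadicG3ParB`'s
floors for the v2 closed forms, plus the two facts lp-1's v2 exits asked for (STATUS 2026-08-27T02:42:53Z /
02:54:15Z):
* `W + log(2 LG) + 1 ≤ W_LG`, `(n+1)·LG·W_LG ≤ G·XG·LG/64`, `HG ≤ G XG/(64(n+1))`, `XG ≤ 9 HG`,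
  `L₀G ≤ G·XG·LG/(4·yloadG) + 1`, `MordG 0 0 ≤ (449/27)(n+1) Lg`;
* **`yloadG ≤ 11·G`** under `½ ≤ θ₀` and `N_q ≤ 2ⁿ K` (so every `X`-free logarithm is `O(G)`);
* **`g^{n+1} ≤ 7^{n+1}·K`** under `½ ≤ θ₀` and `p − 1 ≤ K₀` (the twist-class count of `exists_slab_box`):
  at `m = 0`, `g ≤ log p/(4(n+1))` and `(log p/(n+1))^{n+1} ≤ p − 1 ≤ K₀ = K`; at `m ≥ 1`, `log p < 16(n+1)` so `g < 7`.

## References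
* [Nesterenko2003] Yu. V. Nesterenko, *Linear forms in logarithms of rational numbers*, LNM 1819 (2003) — §3.5.
* [Yu2013] K. Yu, Acta Math. 211 (2013) — §3.1.
-/

noncomputable section

open Finset Real

namespace Summit.ABC.StewartYu

namespace PadicG3Par

variable {n : ℕ} (P : PadicG3Par n)

/-! ### Floors of the v2 family -/

/-- `1 ≤ XG` (real). [folklore] -/
theorem one_le_XG : (1 : ℝ) ≤ P.XG := by linarith [P.XG_ge_128]

/-- `W_LG = 1 + log(1 + 2 e^W LG)`. [folklore] -/
theorem WLG_eq : P.WLG = 1 + Real.log (1 + 2 * Real.exp P.W * P.LG) := by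
  unfold WLG
  rw [Real.log_mul (Real.exp_pos 1).ne' (by positivity), Real.log_exp]

/-- **`W + log(2 LG) + 1 ≤ W_LG`**. [folklore] -/
theorem W_add_log_le_WLG : P.W + Real.log (2 * P.LG) + 1 ≤ P.WLG := by
  rw [P.WLG_eq]
  have hL : (0 : ℝ) < P.LG := by linarith [P.one_le_LG]
  have h1 : Real.log (2 * Real.exp P.W * P.LG) ≤ Real.log (1 + 2 * Real.exp P.W * P.LG) :=
    Real.log_le_log (by positivity) (by linarith)
  have h2 : Real.log (2 * Real.exp P.W * P.LG) = P.W + Real.log (2 * P.LG) := by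
    rw [show 2 * Real.exp P.W * P.LG = Real.exp P.W * (2 * P.LG) by ring,
      Real.log_mul (Real.exp_pos _).ne' (by positivity), Real.log_exp]
  linarith

/-- `log LG ≤ W_LG`. [folklore] -/
theorem log_LG_le_WLG : Real.log P.LG ≤ P.WLG := by
  have h := P.W_add_log_le_WLG
  have hL : (0 : ℝ) < P.LG := by linarith [P.one_le_LG]
  have h1 : Real.log P.LG ≤ Real.log (2 * P.LG) := Real.log_le_log hL (by linarith)
  linarith [P.hW]

/-- `1 ≤ W_LG`. [folklore] -/
theorem WLG_ge_one : 1 ≤ P.WLG := by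
  have h := P.W_add_log_le_WLG
  have : 0 ≤ Real.log (2 * (P.LG : ℝ)) := Real.log_nonneg (by linarith [P.one_le_LG])
  linarith [P.hW]

/-- **`(n+1)·LG·W_LG ≤ G·XG·LG/64`** (the directional share, first branch of `XG`). [folklore] -/
theorem WLG_mul_le : (n + 1) * P.LG * P.WLG ≤ P.G * P.XG * P.LG / 64 := by
  have h := P.mainG_le_XG
  have hG : 0 < P.G := by linarith [P.eight_le_G]
  have hL : (0 : ℝ) ≤ P.LG := by positivity
  rw [div_le_iff₀ hG] at h
  rw [le_div_iff₀ (by norm_num)]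
  nlinarith

/-- `64 (n+1) ≤ G XG`. [folklore] -/
theorem GXG_ge : (64 : ℝ) * (n + 1) ≤ P.G * P.XG := by
  have h1 := P.eight_le_G
  have h2 := P.sixtyfour_le_XG'
  have h0 : (0 : ℝ) ≤ n := by positivity
  nlinarith

/-- **`HG ≤ G XG/(64 (n+1))`**. [cite: Nesterenko2003, (3.23)] -/
theorem HG_le : (P.HG : ℝ) ≤ P.G * P.XG / (64 * (n + 1)) := by
  have hy : (1 : ℝ) ≤ P.G * P.XG / (64 * (n + 1)) := by
    rw [le_div_iff₀ (by positivity)]; linarith [P.GXG_ge]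
  unfold HG
  rw [Nat.cast_max, Nat.cast_one]
  exact max_le hy (Nat.floor_le (by linarith))

/-- `G XG/(64 (n+1)) − 1 < HG`. [folklore] -/
theorem HG_gt : P.G * P.XG / (64 * (n + 1)) - 1 < P.HG := by
  have h1 := Nat.lt_floor_add_one (P.G * P.XG / (64 * (n + 1)))
  have h2 : (⌊P.G * P.XG / (64 * (n + 1))⌋₊ : ℝ) ≤ P.HG := by
    unfold HG; exact_mod_cast le_max_right _ _
  linarith

/-- **`XG ≤ 9 HG`** (`G ≥ 8(n+1)`, `XG ≥ 72`). [folklore] -/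
theorem XG_le_nine_HG : (P.XG : ℝ) ≤ 9 * P.HG := by
  have h1 := P.HG_gt
  have hG := P.cG_mul_le_G
  unfold cG at hG
  have hX := P.XG_ge_128
  have h2 : (P.XG : ℝ) / 8 ≤ P.G * P.XG / (64 * (n + 1)) := by
    rw [div_le_div_iff₀ (by norm_num) (by positivity)]
    have h0 : (0 : ℝ) ≤ P.XG := by linarith
    nlinarith
  linarith

/-- `C_bⁿ Ω K/gⁿ ≤ LG G/(24 yloadG)`. [folklore] -/
theorem coreG_le : Cb ^ n * P.Ω * P.K / P.g ^ n ≤ P.LG * P.G / (24 * P.yloadG) := by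
  have h := P.mainG_le_LG
  have hG : 0 < P.G := by linarith [P.eight_le_G]
  have hY := P.yloadG_pos
  have hg : 0 < P.g ^ n := pow_pos (lt_of_lt_of_le one_pos P.one_le_g) n
  rw [le_div_iff₀ (by positivity)]
  rw [div_le_iff₀ (by positivity)] at h
  have e : Cb ^ n * P.Ω * P.K / P.g ^ n * (24 * P.yloadG) =
      24 * Cb ^ n * P.Ω * P.K * P.yloadG / P.g ^ n := by field_simp
  rw [e, div_le_iff₀ hg]
  linarith

/-- **`L₀G ≤ G XG LG/(4·yloadG) + 1`**. [folklore] -/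
theorem L0G_le : (P.L0G : ℝ) ≤ P.G * P.XG * P.LG / (4 * P.yloadG) + 1 := by
  have h1 := P.L0G_lt
  have h2 := P.coreG_le
  have hY := P.yloadG_pos
  have hX : (0 : ℝ) ≤ P.XG := by positivity
  have hg : 0 < P.g ^ n := pow_pos (lt_of_lt_of_le one_pos P.one_le_g) n
  have h3 : 6 * P.XG * Cb ^ n * P.Ω * P.K / P.g ^ n ≤ P.G * P.XG * P.LG / (4 * P.yloadG) := by
    have : 6 * P.XG * (Cb ^ n * P.Ω * P.K / P.g ^ n) ≤ 6 * P.XG * (P.LG * P.G / (24 * P.yloadG)) :=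
      mul_le_mul_of_nonneg_left h2 (by positivity)
    have e1 : 6 * P.XG * (Cb ^ n * P.Ω * P.K / P.g ^ n) = 6 * P.XG * Cb ^ n * P.Ω * P.K / P.g ^ n := by
      field_simp
    have e2 : 6 * P.XG * (P.LG * P.G / (24 * P.yloadG)) = P.G * P.XG * P.LG / (4 * P.yloadG) := by
      field_simp; ring
    rw [e1, e2] at this; exact this
  linarith

/-- `L₀G · yloadG ≤ G XG LG/4 + yloadG`. [folklore] -/
theorem L0G_mul_yloadG_le : P.L0G * P.yloadG ≤ P.G * P.XG * P.LG / 4 + P.yloadG := by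
  have h := P.L0G_le
  have hY := P.yloadG_pos
  have := mul_le_mul_of_nonneg_right h hY.le
  have e : (P.G * P.XG * P.LG / (4 * P.yloadG) + 1) * P.yloadG = P.G * P.XG * P.LG / 4 + P.yloadG := by
    field_simp
  linarith

/-- `MG = 16 (n+1) Lg` (real). [folklore] -/
theorem MG_real : (P.MG : ℝ) = 16 * (n + 1) * P.Lg := by rw [P.MG_eq]; push_cast; ring

/-- **`MordG 0 0 ≤ (16 + 16/27)(n+1) Lg + (n+1)(ŜG+1)`**. [cite: Nesterenko2003, (3.25)] -/
theorem MordG_zero_zero_real_le :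
    (P.MordG 0 0 : ℝ) ≤ (448 / 27) * (n + 1) * P.Lg + (n + 1) * (P.SdG + 1) := by
  have h := P.MordG_zero_zero_le
  have h1 : ((P.MordG 0 0 : ℕ) : ℝ) ≤ ((P.MG / (n + 2) ^ 3 + (n + 1) * (16 * P.Lg + (P.SdG + 1)) : ℕ) : ℝ) := by
    exact_mod_cast h
  have h2 : ((P.MG / (n + 2) ^ 3 : ℕ) : ℝ) ≤ (P.MG : ℝ) / 27 := by
    have h3 : P.MG / (n + 2) ^ 3 ≤ P.MG / 27 :=
      Nat.div_le_div_left (le_trans (by norm_num) (Nat.pow_le_pow_left (show 3 ≤ n + 2 by have := P.hn; omega) 3))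
        (by norm_num)
    calc ((P.MG / (n + 2) ^ 3 : ℕ) : ℝ) ≤ ((P.MG / 27 : ℕ) : ℝ) := by exact_mod_cast h3
      _ ≤ (P.MG : ℝ) / 27 := Nat.cast_div_le
  push_cast at h1
  rw [P.MG_real] at h2
  linarith

/-! ### `yloadG ≤ 11 G` -/

/-- `lgg · log 2 ≤ 0.7 (g + 1)`. [folklore] -/
theorem lgg_log_two_le : (P.lgg : ℝ) * Real.log 2 ≤ (7 / 10) * (P.g + 1) := by
  have h1 : P.lgg ≤ P.gceil := by
    unfold lgg
    exact (Nat.clog_le_iff_le_pow (by norm_num)).mpr (Nat.lt_two_pow_self).le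
  have h2 : (P.gceil : ℝ) < P.g + 1 := Nat.ceil_lt_add_one (lt_of_lt_of_le one_pos P.one_le_g).le
  have h3 : (P.lgg : ℝ) ≤ P.gceil := by exact_mod_cast h1
  have hl := Real.log_two_lt_d9
  have hl0 : 0 ≤ Real.log 2 := Real.log_nonneg (by norm_num)
  nlinarith

/-- **`yloadG ≤ 11·G`** under `½ ≤ θ₀` and `N_q ≤ 2ⁿ K`. [folklore] -/
theorem yloadG_le_eleven_G (hθ : 1 / 2 ≤ P.θ₀) (hNqK : P.Nq ≤ 2 ^ n * P.K) : P.yloadG ≤ 11 * P.G := by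
  have hG8 := P.cG_mul_le_G
  unfold cG at hG8
  have hn1 : (1 : ℝ) ≤ n := by exact_mod_cast P.hn
  have hG16 : (16 : ℝ) ≤ P.G := by nlinarith
  have hlogp : Real.log P.p ≤ 2 * P.G := by
    have := P.θ₀_log_le_G; have := P.log_p_pos; nlinarith
  have hl := Real.log_two_lt_d9
  have hl0 : 0 ≤ Real.log 2 := Real.log_nonneg (by norm_num)
  -- `log N_q ≤ n log 2 + log K ≤ n log 2 + G + log p`
  have hNq : Real.log P.Nq ≤ n * Real.log 2 + 2 * P.G := by
    have hNq0 : (0 : ℝ) < P.Nq := by exact_mod_cast P.hNq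
    have h1 : (P.Nq : ℝ) ≤ 2 ^ n * P.K := by exact_mod_cast hNqK
    have h2 := Real.log_le_log hNq0 h1
    rw [Real.log_mul (by positivity) P.K_pos.ne', Real.log_pow] at h2
    linarith [P.log_K_le hθ]
  have hSd : (P.SdG : ℝ) * Real.log 2 ≤
      (n + 24) * Real.log 2 + Real.log P.Nq + (7 / 10) * (P.g + 1) := by
    unfold SdG; push_cast
    have := P.natlog_mul_log_two_le; have := P.lgg_log_two_le
    nlinarith
  have hg : P.g ≤ P.G / 16 := by
    rw [P.G_eq_mul_g]
    have : (1 : ℝ) ≤ n := by exact_mod_cast P.hn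
    have := P.one_le_g
    nlinarith
  have hn : (n : ℝ) ≤ P.G / 8 - 1 := P.n_le
  have hlogn : Real.log ((n : ℝ) + 1) ≤ n := by
    have := Real.log_le_sub_one_of_pos (show (0 : ℝ) < n + 1 by positivity); linarith
  unfold yloadG
  have e : ((P.SdG : ℝ) + n + 1) * Real.log 2 = P.SdG * Real.log 2 + (n + 1) * Real.log 2 := by ring
  rw [e]
  nlinarith

/-! ### `g^{n+1} ≤ 7^{n+1} K` -/

/-- `1 + y^k ≤ (1 + y)^k` for `y ≥ 0`, `k ≥ 1`. [folklore] -/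
theorem one_add_pow_le_pow {y : ℝ} (hy : 0 ≤ y) : ∀ k : ℕ, 1 ≤ k → 1 + y ^ k ≤ (1 + y) ^ k
  | 0, h => by omega
  | 1, _ => by simp
  | k + 2, _ => by
    have ih := one_add_pow_le_pow hy (k + 1) (by omega)
    have h1 : 0 ≤ y ^ (k + 1) := by positivity
    calc 1 + y ^ (k + 2) ≤ (1 + y) * (1 + y ^ (k + 1)) := by rw [pow_succ]; nlinarith
      _ ≤ (1 + y) * (1 + y) ^ (k + 1) := mul_le_mul_of_nonneg_left ih (by linarith)
      _ = (1 + y) ^ (k + 2) := by rw [pow_succ]; ring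

/-- **`g^{n+1} ≤ 7^{n+1}·K`** under `½ ≤ θ₀` and `p − 1 ≤ K₀`: at `m = 0`,
`g ≤ log p/(4(n+1))` and `(log p/(n+1))^{n+1} + 1 ≤ e^{log p} = p`; at `m ≥ 1`, `g < 7`. [folklore] -/
theorem pow_g_le (hθ : 1 / 2 ≤ P.θ₀) (hK₀ : (P.p : ℝ) - 1 ≤ P.K₀) : P.g ^ (n + 1) ≤ 7 ^ (n + 1) * P.K := by
  have hg1 := P.one_le_g
  have hK1 : (1 : ℝ) ≤ P.K := by exact_mod_cast P.one_le_K
  have hlog := P.log_p_pos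
  by_cases hm : P.m = 0
  · -- `m = 0`: `G = θ₀ log p ≤ 2 log p`, `g = G/(8(n+1)) ≤ y/4` with `y = log p/(n+1)`
    have hG : P.G = P.θ₀ * Real.log P.p := by unfold G θm; rw [hm]; push_cast; ring
    set y : ℝ := Real.log P.p / (n + 1) with hy
    have hy0 : 0 ≤ y := by positivity
    have hgy : P.g ≤ y := by
      unfold g cG; rw [hG, hy]
      rw [div_le_div_iff₀ (by positivity) (by positivity)]
      have hθ2 := P.hθ₀2
      have hθlog : P.θ₀ * Real.log P.p ≤ 2 * Real.log P.p := by nlinarith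
      have hn0 : (0 : ℝ) ≤ (n : ℝ) + 1 := by positivity
      nlinarith [mul_le_mul_of_nonneg_right hθlog hn0]
    have hKe : (P.K : ℝ) = P.K₀ := by unfold K; rw [hm]; push_cast; ring
    -- `y^{n+1} + 1 ≤ (1+y)^{n+1} ≤ (e^y)^{n+1} = p`
    have h1 : 1 + y ^ (n + 1) ≤ (1 + y) ^ (n + 1) := one_add_pow_le_pow hy0 (n + 1) (by omega)
    have h2 : (1 + y) ^ (n + 1) ≤ Real.exp y ^ (n + 1) :=
      pow_le_pow_left₀ (by linarith) (by linarith [Real.add_one_le_exp y]) _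
    have h3 : Real.exp y ^ (n + 1) = P.p := by
      rw [← Real.exp_nat_mul, hy]
      rw [show ((n + 1 : ℕ) : ℝ) * (Real.log P.p / (n + 1)) = Real.log P.p by push_cast; field_simp]
      exact Real.exp_log (by linarith [P.two_le_p])
    have h4 : y ^ (n + 1) ≤ P.K := by rw [hKe]; linarith
    have h7 : (1 : ℝ) ≤ 7 ^ (n + 1) := one_le_pow₀ (by norm_num)
    calc P.g ^ (n + 1) ≤ y ^ (n + 1) := pow_le_pow_left₀ (by linarith) hgy _
      _ ≤ P.K := h4
      _ ≤ 7 ^ (n + 1) * P.K := by nlinarith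
  · -- `m ≥ 1`: `θ₀ log p < 8(n+1)` so `log p < 16(n+1)` and `G ≤ 8(n+1) + 3 log p < 56(n+1)`, `g < 7`
    have hm1 : 1 ≤ P.m := Nat.one_le_iff_ne_zero.mpr hm
    have h1 := P.θ₀_log_lt_of_m_pos hm1
    unfold cG at h1
    have h2 := P.G_le
    unfold cG at h2
    have hθ2 := P.hθ₀2
    have hlogp : Real.log P.p < 16 * (n + 1) := by nlinarith
    have hG : P.G < 56 * (n + 1) := by nlinarith
    have hg7 : P.g ≤ 7 := by
      unfold g cG
      rw [div_le_iff₀ (by positivity)]; linarith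
    calc P.g ^ (n + 1) ≤ 7 ^ (n + 1) := pow_le_pow_left₀ (by linarith) hg7 _
      _ ≤ 7 ^ (n + 1) * P.K := by nlinarith [pow_pos (show (0:ℝ) < 7 by norm_num) (n + 1)]

end PadicG3Par

end Summit.ABC.StewartYu
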